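import Summits.CriticalPhenomena.PercolationContinuityZ3.Theorems.Transplant.SkelKitResiduesOF
import Summits.CriticalPhenomena.PercolationContinuityZ3.Theorems.Transplant.KNCells2CoverO
import HarnessLib

/-!
# N2 (frames-only node `SamePDropOfSkeletonFrm₁`, OPEN), (C) column: **THE RUN-RESTRICTED ORIENTED CORRIDOR OBLIGATION FROM ITS TWO ONWARD-AXIS
# INSTANCES** — `Skel.reachOblRHNOF_of_axes` (twin of `Skel.rootOblTWF_of_axes`, SkelRootSeedLawF): under the fixed quadrant `qNE` every onward
# direction of a valid oriented examination is `(a, true)`, `a : Fin 2`, and does not point back at the source (`KSchA.du_ne_rev₂O`), so the (C)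
# residue `Skel.ReachOblRHNOF G nmax S FD Δ' δ` (SkelKitResiduesOF, C2-SPEC §2) follows from the first-axis and second-axis residues at every valid
# probe — the packaging step of the (C) wrapper `reachHoldsRHNQFnL_frmChoiceAllQ3` over `reachOblAtHNF_of_kgCorrS / _YS` (SkelPhiCorridorKGRoomsQ/QY).
builds on p205010 (kernel theorem, internal audit signed; external expert review pending) — nothing in this file uses p205010; nothing here is a
claim about the open node `SamePDropOfSkeletonFrm₁`.
Lane `prim-bschramm`, seat `prim-bschramm-p5` (gen 16; (C) lineage); helper file (`--supports stmt-CriticalPhenomena-4575 --as helper`).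
[cite: KozmaNitzan2024, §4 p. 30 (Step IV), Lemma 12 (pp. 23–25)]
-/

noncomputable section

open MeasureTheory ProbabilityTheory
open scoped ENNReal Classical

namespace Summit.CriticalPhenomena.PercolationContinuityZ3.Theorems

namespace Transplant

namespace Skel

open Literature.Probability.Percolation Literature.Probability.LatticeModels SimpleGraph GadgetSystem ProbeHistory HSiteScheme Contour KNCells
open KNCells.KSchA

variable {V : Type} [DecidableEq V] [Countable V] {G : SimpleGraph V} [G.LocallyFinite] {A : Type*}

omit [Countable V] in
/-- **`ReachOblRHNOF` from its two ONWARD-AXIS instances**: under the fixed quadrant `qNE` every onward direction of a valid oriented examination is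
`(a, true)` for an axis `a : Fin 2` and does not point back at the source; so the first-axis and second-axis residues at every valid probe give the
run-restricted oriented corridor obligation (twin of `rootOblTWF_of_axes`, SkelRootSeedLawF). [cite: KozmaNitzan2024, §4 p. 30 (Step IV)] -/
theorem reachOblRHNOF_of_axes {nmax : ℕ} {S : KSchA V A} {FD : FaceData V A} {Δ' : ℕ} {δ : ℝ}
    (h0 : ∀ h e, S.IsRun₂O G h → (S.astOf₂O G h).st.ochoice KSchA.qNE = some e → S.Valid₂O G h e →
      ((0 : Fin 2), true) ∈ S.onwardO G h (tgt e) → ((0 : Fin 2), true) ≠ rev e.2 →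
        ReachOblAtHNF G nmax S FD Δ' δ h e (S.aOf₂O G h e) ((0 : Fin 2), true))
    (h1 : ∀ h e, S.IsRun₂O G h → (S.astOf₂O G h).st.ochoice KSchA.qNE = some e → S.Valid₂O G h e →
      ((1 : Fin 2), true) ∈ S.onwardO G h (tgt e) → ((1 : Fin 2), true) ≠ rev e.2 →
        ReachOblAtHNF G nmax S FD Δ' δ h e (S.aOf₂O G h e) ((1 : Fin 2), true)) :
    ReachOblRHNOF G nmax S FD Δ' δ := by
  intro h e hrun hc hV du hdu
  have hne : du ≠ rev e.2 := KSchA.du_ne_rev₂O hV hdu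
  obtain ⟨a, b⟩ := du
  have hb : b = true := ((KSchA.mem_onwardO G S).1 hdu).2
  subst hb
  fin_cases a
  · exact h0 h e hrun hc hV hdu hne
  · exact h1 h e hrun hc hV hdu hne

end Skel

end Transplant

end Summit.CriticalPhenomena.PercolationContinuityZ3.Theorems

end
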